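import Literature.NumberTheory.Weil1964.AdelicDoublingDefectCharacter
import Literature.NumberTheory.Weil1964.AdelicMetaplecticProjSurjective
import Literature.NumberTheory.Weil1964.AdelicMetaplecticL2Scalar
import HarnessLib

/-!
# External tensor of two implementers as ONE implementer of the doubled space: `ω(k)(Φ₁ ⊠ Ψ₂) = ω(p₁)Φ₁ ⊠ ω_{−T}(p₂)Ψ₂`

Topic `NumberTheory/Weil1964`; namespace `Literature.NumberTheory.Weil1964`.  KERNEL MATHEMATICS ONLY (theorems; no definition,
no named fact, no proof hole).

[Weil1964, Chap. III n° 38 pp. 189–190] (restriction of `𝐫` to an orthogonal direct sum) ∕ [MoeglinVignerasWaldspurger1987, Chap. 2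
II.1 Rem. (6)] ∕ [Kudla1984, §1]: over `Sp(W₁) × Sp(W₂) ⊂ Sp(W₁ ⊕ W₂)` the metaplectic representation of the sum restricts to the
external tensor of the two.  For the DOUBLED space `W ⊕ W⁻` of the tree (`doubledGramFin F T = reindex (T ⊕ (−T))` on `Fin (n + n)`,
`AdelicDoublingDiagonalLift`) we prove the «produce» direction in the group of record `Mp_ψ((W ⊕ W⁻)_𝔸)ᶜᵒⁿᵗ`:

* **`exists_sumImplementer`**: for `p₁ ∈ Mp_ψ(W_T)ᶜᵒⁿᵗ`, `p₂ ∈ Mp_ψ(W_{−T})ᶜᵒⁿᵗ` there is `k ∈ Mp_ψ((W ⊕ W⁻)_𝔸)ᶜᵒⁿᵗ` over the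
  block-diagonal symplectic element `π(p₁) ⊕ π(p₂)` (read on `Fin (n + n)`) whose Weil operator IS the external tensor EXACTLY:
  `ω(k) (Φ₁ ⊠ Ψ₂) = ω(p₁) Φ₁ ⊠ ω_{−T}(p₂) Ψ₂` for all `Φ₁, Ψ₂` (an implementer exists by ★ `adelicMpCont.proj_surjective`; it is the
  tensor up to ONE scalar `c ≠ 0` by the two-factor Schur lemma ★ `exists_ne_zero_smul_tensorToSum_of_fst_eq_spSum`; rescale by the
  central `(1, c⁻¹)`);
* **`exists_sumImplementer_conj`**: the case `p₂ = qᶜ` — `ω(k) (Φ₁ ⊠ Φ̄₂) = ω(p₁) Φ₁ ⊠ conj (ω(q) Φ₂)` — the shape «W-TRANSLATES ARE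
  IMPLEMENTED OVER THE BLOCK-DIAGONAL» (stub SW1 (ii′) of the E-2 Siegel–Weil sub-line: the pair `(ω(x₁⁻¹)Φ₁, conj ω(x₂⁻¹)Φ₂)` of the
  Rallis inner kernel is `ω□(k)(Φ₁ ⊠ Φ̄₂)` for an implementer `k` over `ι(1,x₁)⁻¹ ⊕ ι(1,x₂)⁻¹`, with unit scalar `1`).

## References
* [Weil1964] A. Weil, Acta Math. 111 (1964), Chap. III n° 37–38 pp. 188–190.
* [MoeglinVignerasWaldspurger1987] C. Mœglin, M.-F. Vignéras, J.-L. Waldspurger, LNM 1291 (1987), Chap. 2 II.1 (A)–(B), Rem. (6).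
* [Kudla1984] S. Kudla, Progr. Math. 46 (1984), §1.
-/

noncomputable section

open NumberField
open scoped ComplexConjugate

namespace Literature.NumberTheory.Weil1964

open Literature.RepresentationTheory.HeisenbergGroup Literature.NumberTheory.Automorphic
open Literature.NumberTheory.Automorphic.UnitaryGroup (spReindex spSum)

section SumImplementer

variable (F : Type) [Field F] [NumberField F] {n : ℕ}
variable (T : Matrix (Fin n) (Fin n) (AdeleRing (𝓞 F) F)) (hT : IsUnit T.det)

/-- round trip of the coordinate readers around an automorphism `L` of `W_𝔸`. [folklore] -/
private theorem reindexW_roundtrip' {ι ι' : Type} (e : ι ≃ ι')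
    (L : ((ι → AdeleRing (𝓞 F) F) × (ι → AdeleRing (𝓞 F) F)) ≃ₗ[AdeleRing (𝓞 F) F]
      ((ι → AdeleRing (𝓞 F) F) × (ι → AdeleRing (𝓞 F) F)))
    (v : (ι → AdeleRing (𝓞 F) F) × (ι → AdeleRing (𝓞 F) F)) :
    UnitaryGroup.reindexW (AdeleRing (𝓞 F) F) e.symm (UnitaryGroup.reindexW (AdeleRing (𝓞 F) F) e
      (L ((UnitaryGroup.reindexW (AdeleRing (𝓞 F) F) e).symm
        ((UnitaryGroup.reindexW (AdeleRing (𝓞 F) F) e.symm).symm v)))) = L v := by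
  have h1 : (UnitaryGroup.reindexW (AdeleRing (𝓞 F) F) e).symm
      ((UnitaryGroup.reindexW (AdeleRing (𝓞 F) F) e.symm).symm v) = v := by
    refine Prod.ext (funext fun i => ?_) (funext fun i => ?_) <;>
      simp only [UnitaryGroup.reindexW_symm_apply, Function.comp_apply, Equiv.symm_apply_apply]
  have h2 : ∀ w : (ι → AdeleRing (𝓞 F) F) × (ι → AdeleRing (𝓞 F) F),
      UnitaryGroup.reindexW (AdeleRing (𝓞 F) F) e.symm (UnitaryGroup.reindexW (AdeleRing (𝓞 F) F) e w) = w := fun w => by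
    refine Prod.ext (funext fun i => ?_) (funext fun i => ?_) <;>
      simp only [UnitaryGroup.reindexW_apply, Function.comp_apply, Equiv.symm_symm, Equiv.symm_apply_apply]
  rw [h1, h2]

/-- the projection after the sum transport along `Fin (n + n) ≃ Fin n ⊕ Fin n` of an element over `e (g₁ ⊕ g₂) e⁻¹` is
`g₁ ⊕ g₂`. [cite: MoeglinVignerasWaldspurger1987, Chap. 2 II.1 (A)] -/
theorem proj_sumTransport_eq_spSum_of_proj_eq {k : adelicMpCont F (Fin (n + n)) (doubledGramFin F T)}
    {g₁ : symplecticGroup (polar (adelicForm F (Fin n) T))} {g₂ : symplecticGroup (polar (adelicForm F (Fin n) (-T)))}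
    (hk : adelicMpCont.proj F (Fin (n + n)) (doubledGramFin F T) k =
      spReindex finSumFinEquiv (Matrix.fromBlocks T 0 0 (-T)) (spSum T (-T) (g₁, g₂))) :
    adelicMpCont.proj F (Fin n ⊕ Fin n) (Matrix.fromBlocks T 0 0 (-T))
        (sumTransport F finSumFinEquiv.symm (reindex_symm_doubledGramFin F T) k) =
      spSum T (-T) (g₁, g₂) := by
  refine Subtype.ext (LinearEquiv.ext fun v => ?_)
  refine (coe_proj_sumTransport_apply F finSumFinEquiv.symm (reindex_symm_doubledGramFin F T) k v).trans ?_
  refine (congrArg (fun y : symplecticGroup (polar (adelicForm F (Fin (n + n)) (doubledGramFin F T))) =>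
    UnitaryGroup.reindexW (AdeleRing (𝓞 F) F) finSumFinEquiv.symm
      (y.1 ((UnitaryGroup.reindexW (AdeleRing (𝓞 F) F) finSumFinEquiv.symm).symm v))) hk).trans ?_
  exact (congrArg (UnitaryGroup.reindexW (AdeleRing (𝓞 F) F) finSumFinEquiv.symm)
    (UnitaryGroup.coe_spReindex_apply finSumFinEquiv (Matrix.fromBlocks T 0 0 (-T)) (spSum T (-T) (g₁, g₂)) _)).trans
    (reindexW_roundtrip' F finSumFinEquiv _ v)

include hT in
/-- **AN IMPLEMENTER OF THE SUM IS THE EXTERNAL TENSOR, EXACTLY**: for `p₁ ∈ Mp_ψ(W_T)ᶜᵒⁿᵗ`, `p₂ ∈ Mp_ψ(W_{−T})ᶜᵒⁿᵗ` there is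
`k ∈ Mp_ψ((W ⊕ W⁻)_𝔸)ᶜᵒⁿᵗ` with `π(k) = π(p₁) ⊕ π(p₂)` (read on `Fin (n + n)`) and `ω(k)(Φ₁ ⊠ Ψ₂) = ω(p₁)Φ₁ ⊠ ω_{−T}(p₂)Ψ₂` for ALL
`Φ₁, Ψ₂`. [cite: Weil1964, Chap. III n° 38 pp. 189–190] [cite: MoeglinVignerasWaldspurger1987, Chap. 2 II.1 Rem. (6)] -/
theorem exists_sumImplementer (p₁ : adelicMpCont F (Fin n) T) (p₂ : adelicMpCont F (Fin n) (-T)) :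
    ∃ k : adelicMpCont F (Fin (n + n)) (doubledGramFin F T),
      adelicMpCont.proj F (Fin (n + n)) (doubledGramFin F T) k =
          spReindex finSumFinEquiv (Matrix.fromBlocks T 0 0 (-T))
            (spSum T (-T) (adelicMpCont.proj F (Fin n) T p₁, adelicMpCont.proj F (Fin n) (-T) p₂)) ∧
        ∀ (Φ₁ Ψ₂ : piSchwartzBruhat F (Fin n)),
          adelicMpCont.omega F (Fin (n + n)) (doubledGramFin F T) k (sumTensor F finSumFinEquiv.symm Φ₁ Ψ₂) =
            sumTensor F finSumFinEquiv.symm (adelicMpCont.omega F (Fin n) T p₁ Φ₁)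
              (adelicMpCont.omega F (Fin n) (-T) p₂ Ψ₂) := by
  -- an implementer `k₀` over `π(p₁) ⊕ π(p₂)` exists
  refine (adelicMpCont.proj_surjective F (doubledGramFin F T) (isUnit_det_doubledGramFin F T hT)
    (spReindex finSumFinEquiv (Matrix.fromBlocks T 0 0 (-T))
      (spSum T (-T) (adelicMpCont.proj F (Fin n) T p₁, adelicMpCont.proj F (Fin n) (-T) p₂)))).elim fun k₀ hk₀ => ?_
  -- read it in sum coordinates and compare with the tensor (two-factor Schur): one scalar `c ≠ 0`
  have hq₀ := proj_sumTransport_eq_spSum_of_proj_eq F T hk₀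
  refine (exists_ne_zero_smul_tensorToSum_of_fst_eq_spSum ((Matrix.isUnit_iff_isUnit_det T).mpr hT)
    ((Matrix.isUnit_iff_isUnit_det T).mpr hT).neg (p₁ : adelicMp F (Fin n) T) p₁.2 (p₂ : adelicMp F (Fin n) (-T)) p₂.2
    (sumTransport F finSumFinEquiv.symm (reindex_symm_doubledGramFin F T) k₀ :
      adelicMp F (Fin n ⊕ Fin n) (Matrix.fromBlocks T 0 0 (-T)))
    (sumTransport F finSumFinEquiv.symm (reindex_symm_doubledGramFin F T) k₀).2 hq₀).elim fun c hc => ?_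
  -- rescale by the central `(1, c⁻¹)`
  refine ⟨adelicMpCont.ofScalar F (Fin (n + n)) (doubledGramFin F T) (Units.mk0 c hc.1)⁻¹ * k₀, ?_, fun Φ₁ Ψ₂ => ?_⟩
  · exact ((map_mul (adelicMpCont.proj F (Fin (n + n)) (doubledGramFin F T)) _ _).trans
      ((congrArg (· * adelicMpCont.proj F (Fin (n + n)) (doubledGramFin F T) k₀)
        (adelicMpCont.proj_ofScalar (F := F) (ι := Fin (n + n)) (T := doubledGramFin F T) _)).trans
          (one_mul _))).trans hk₀
  · -- `ω(k₀) (sumTensor Φ₁ Ψ₂) = R_e⁻¹ (ω(sumTransport k₀) (Φ₁ ⊠ Ψ₂)) = c • sumTensor (ω p₁ Φ₁) (ω p₂ Ψ₂)`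
    have h1 : adelicMpCont.omega F (Fin (n + n)) (doubledGramFin F T) k₀ (sumTensor F finSumFinEquiv.symm Φ₁ Ψ₂) =
        c • sumTensor F finSumFinEquiv.symm (adelicMpCont.omega F (Fin n) T p₁ Φ₁) (adelicMpCont.omega F (Fin n) (-T) p₂ Ψ₂) := by
      have h2 := omega_sumTransport_apply F finSumFinEquiv.symm (reindex_symm_doubledGramFin F T) k₀
        (tensorToSum F (Fin n) (Fin n) Φ₁ Ψ₂)
      -- `h2 : ω(sumTransport k₀) (Φ₁ ⊠ Ψ₂) = R (ω k₀ (R⁻¹ (Φ₁ ⊠ Ψ₂)))`, and `hc.2` evaluates the left side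
      have h3 : piSBReindex F finSumFinEquiv.symm (adelicMpCont.omega F (Fin (n + n)) (doubledGramFin F T) k₀
            (sumTensor F finSumFinEquiv.symm Φ₁ Ψ₂)) =
          c • tensorToSum F (Fin n) (Fin n) (adelicMpCont.omega F (Fin n) T p₁ Φ₁) (adelicMpCont.omega F (Fin n) (-T) p₂ Ψ₂) :=
        h2.symm.trans (hc.2 Φ₁ Ψ₂)
      exact ((piSBReindex F finSumFinEquiv.symm).symm_apply_apply _).symm.trans
        ((congrArg (piSBReindex F finSumFinEquiv.symm).symm h3).trans
          ((LinearEquiv.map_smul (piSBReindex F finSumFinEquiv.symm).symm c _).trans rfl))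
    refine (adelicMpCont.omega_mul_apply F (doubledGramFin F T)
      (adelicMpCont.ofScalar F (Fin (n + n)) (doubledGramFin F T) (Units.mk0 c hc.1)⁻¹) k₀
      (sumTensor F finSumFinEquiv.symm Φ₁ Ψ₂)).trans ?_
    refine (congrArg (adelicMpCont.omega F (Fin (n + n)) (doubledGramFin F T)
      (adelicMpCont.ofScalar F (Fin (n + n)) (doubledGramFin F T) (Units.mk0 c hc.1)⁻¹)) h1).trans ?_
    refine (adelicMpCont.omega_ofScalar _ _).trans ?_
    exact (smul_smul _ _ _).trans ((congrArg (· • sumTensor F finSumFinEquiv.symm (adelicMpCont.omega F (Fin n) T p₁ Φ₁)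
      (adelicMpCont.omega F (Fin n) (-T) p₂ Ψ₂)) (Units.inv_mul (Units.mk0 c hc.1))).trans (one_smul ℂ _))

include hT in
/-- **… with the conjugate model in the second slot**: for `p₁, q ∈ Mp_ψ(W_T)ᶜᵒⁿᵗ` there is `k ∈ Mp_ψ((W ⊕ W⁻)_𝔸)ᶜᵒⁿᵗ` over
`π(p₁) ⊕ π(qᶜ)` with `ω(k)(Φ₁ ⊠ Φ̄₂) = ω(p₁)Φ₁ ⊠ conj (ω(q)Φ₂)` for all `Φ₁ Φ₂` — the pair of W-translates of the Rallis inner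
kernel is ONE doubled Weil operator applied to `Φ₁ ⊠ Φ̄₂` (unit scalar `1`). [cite: Weil1964, Chap. III n° 38 pp. 189–190] [cite: Kudla1984, §1] -/
theorem exists_sumImplementer_conj (p₁ q : adelicMpCont F (Fin n) T) :
    ∃ k : adelicMpCont F (Fin (n + n)) (doubledGramFin F T),
      adelicMpCont.proj F (Fin (n + n)) (doubledGramFin F T) k =
          spReindex finSumFinEquiv (Matrix.fromBlocks T 0 0 (-T))
            (spSum T (-T) (adelicMpCont.proj F (Fin n) T p₁, adelicMpCont.proj F (Fin n) (-T) (adelicMpContConj F (Fin n) T q))) ∧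
        ∀ (Φ₁ Φ₂ : piSchwartzBruhat F (Fin n)),
          adelicMpCont.omega F (Fin (n + n)) (doubledGramFin F T) k
              (sumTensor F finSumFinEquiv.symm Φ₁ (piSchwartzBruhatConj F (Fin n) Φ₂)) =
            sumTensor F finSumFinEquiv.symm (adelicMpCont.omega F (Fin n) T p₁ Φ₁)
              (piSchwartzBruhatConj F (Fin n) (adelicMpCont.omega F (Fin n) T q Φ₂)) := by
  refine (exists_sumImplementer F T hT p₁ (adelicMpContConj F (Fin n) T q)).elim fun k hk => ⟨k, hk.1, fun Φ₁ Φ₂ => ?_⟩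
  exact (hk.2 Φ₁ (piSchwartzBruhatConj F (Fin n) Φ₂)).trans
    (congrArg (sumTensor F finSumFinEquiv.symm (adelicMpCont.omega F (Fin n) T p₁ Φ₁))
      ((adelicMpCont.omega_adelicMpContConj_apply q (piSchwartzBruhatConj F (Fin n) Φ₂)).trans
        (congrArg (fun Φ => piSchwartzBruhatConj F (Fin n) (adelicMpCont.omega F (Fin n) T q Φ))
          (piSchwartzBruhatConj_piSchwartzBruhatConj Φ₂))))

end SumImplementer

end Literature.NumberTheory.Weil1964

end
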